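import Summits.BirchSwinnertonDyer.BirchSwinnertonDyer.Theorems.BiquadraticEisensteinDescentHeegnerTwistCouplingInSupplySqrtSevenCell
import Summits.BirchSwinnertonDyer.BirchSwinnertonDyer.Theorems.BiquadraticEisensteinDescentHeegnerTwistCouplingInSupplySqrtSevenPin
import Summits.BirchSwinnertonDyer.BirchSwinnertonDyer.Theorems.BiquadraticEisensteinDescentHeegnerTwistCouplingInSupplySqrtTwoCornerFifteenMinimal
import HarnessLib

set_option linter.dupNamespace false -- `Summit.BirchSwinnertonDyer.BirchSwinnertonDyer.Theorems.…` (summit = sub)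
set_option autoImplicit false

/-!
# Crux `HeegnerTwistCouplingInSupply` (stmt-BirchSwinnertonDyer-21381) — the `j = −3375` CORNER: for EVERY prime `p ≡ 3, 19, 27 (mod 56)`
# (`p ≡ 3 (mod 8)` inert in `ℚ(√−7)`) and `W_p = X₀(49)^{(−p)} : y² + xy = x³ − ((21p+1)/4) x² + 7p² x`, the CONCLUSION of the crux —
# a Heegner field `K′ = ℚ(√−ℓ)` of `N(W_p)` with `4 < |d_{K′}|`, `L(W_p^{(d_{K′})}, 1) ≠ 0`, `h(K′) < p`, `p ∤ h(K′)` — modulo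
# Burungale–Tian + Deuring–Hecke ONLY, pin-based (no ladder, no residual density)

Route `BiquadraticEisensteinDescent` (cell `pub/bsd-wall`, width seat `bsd-wall-cm-bed-w1` g11; `--supports` 21381, helper). Assembly of the third CM
family of the corner layer (after `j = 1728`: `…ThreeSquaresPinCorner`, `…IndefinitePinCorner`, the quartic corners; `j = 8000`: `…SqrtTwoCorner*`):

* §1 the family `W_p = ⟨1, −(21p+1)/4, 0, 7p², 0⟩` (`p ≡ 3 (mod 4)`; the minimal model of `49a1^{(−p)}`, `Δ = −7³p⁶`, odd): integral `ℤ`-model,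
  `Δ`, good reduction at every prime `r ∉ {7, p}` INCLUDING `r = 2` (so `2 ∤ N(W_p)` and the witness field may ramify at `2`), the support of
  `N(W_p)`, and the twist identity **`W_p^{(−4ℓ)} = A_{pℓ} = ⟨0, 21pℓ, 0, 112p²ℓ², 0⟩`** on the nose (`b₂ = −21p`, `b₄ = 14p²`, `b₆ = 0`);
* §2 `L(A_n, 1) ≠ 0` on CELL-√7 (`…SqrtSevenCell.selmerCorank_two_eq_zero` + Burungale–Tian at the prime `2` + `j(A_n) = −3375 ∈ maximalCMJInvariants`
  for `HasCM` (`hasCM_of_j_mem_maximalCMJInvariants_holds`) and for the Deuring–Hecke continuation);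
* §3 ★★★ `cruxOnSqrtSevenCorner_of_two_facts` — for EVERY prime `p ≥ 5` with `p % 8 = 3` and `p % 7 ∈ {3, 5, 6}`: the crux conclusion for `W = W_p`
  with `K′ = ℚ(√−ℓ)`, `ℓ` the prime of `…SqrtSevenPin.sqrtSevenPin` (`ℓ ≡ 1 (4)`, `(ℓ/7) = (ℓ/p) = −1`, `4ℓ < 7p`): `7` and `p` split in `K′`,
  `d_{K′} = −4ℓ`, `W_p^{(−4ℓ)} = A_{pℓ}` is in CELL-√7 (`q = p`, `m = ℓ`), `h(K′) < p` (size lever for `p ≥ 23`; `p = 19` by `ℓ = 13`).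

Numerics (kit j315962, PARI, evidence on 21381): for every such `p ≤ 600` the support of `N(49a1^{(−p)})` is `{7, p}`, the root number is `−1`,
the pin's `ℓ` passes all four checks, `h(−4ℓ) < p`, and `ellrank(A_{pℓ}) = 0`. HONEST FRAMING: a corner theorem on ONE CM family (measure zero in
«all CM `W`»; the other half `p ≡ 7 (mod 8)` of its inert primes has no `2`-isogeny cell); the hypotheses `CMInert W p`, `¬ Good W p`,
`r_an(W) = 1` of the crux are not needed for (nor proved with) the conclusion; C⁺ untouched; crux 21381 NOT closed; BSD is not proved by any of
this. THEOREMS ONLY (no `def`, no `sorry`, no new named fact).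
-/

noncomputable section

open scoped Classical NumberField

namespace Summit.BirchSwinnertonDyer.BirchSwinnertonDyer.Theorems.BiquadraticEisensteinDescentHeegnerTwistCouplingInSupplySqrtSevenCorner

open _root_.WeierstrassCurve Literature.NumberTheory.EllipticCurves Literature.NumberTheory
open IsDedekindDomain Rat.HeightOneSpectrum
open Summit.BirchSwinnertonDyer.BirchSwinnertonDyer.Theorems.BiquadraticEisensteinDescentHeegnerTwistCouplingInSupplySqrtSevenCell
open Summit.BirchSwinnertonDyer.BirchSwinnertonDyer.Theorems.BiquadraticEisensteinDescentHeegnerTwistCouplingInSupplySqrtSevenPin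

/-! ## §1 The family `W_p = ⟨1, −(21p+1)/4, 0, 7p², 0⟩` -/

section Family

/-- `4 ∣ 21p + 1` for `p ≡ 3 (mod 4)`, so `(21p+1)/4` is an honest integer: `4·((21p+1)/4) = 21p + 1`. [folklore] -/
theorem four_mul_div (p : ℕ) (hp4 : p % 4 = 3) : 4 * ((21 * p + 1) / 4) = 21 * p + 1 := by
  omega

/-- The `ℤ`-model `⟨1, −(21p+1)/4, 0, 7p², 0⟩` maps to `W_p`. [folklore] -/
theorem map_WInt (p : ℕ) :
    (⟨1, -(((21 * p + 1) / 4 : ℕ) : ℤ), 0, 7 * (p : ℤ) ^ 2, 0⟩ : WeierstrassCurve ℤ).map (Int.castRingHom ℚ) =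
      ⟨1, -(((21 * p + 1) / 4 : ℕ) : ℚ), 0, 7 * (p : ℚ) ^ 2, 0⟩ := by
  ext <;> simp [WeierstrassCurve.map, -Int.natCast_ediv, -Nat.cast_div, Int.cast_natCast]

/-- `Δ(W_p) = −7³ p⁶` (over `ℤ`; `b₂ = −21p`, `b₄ = 14p²`, `b₆ = 0`, `b₈ = −49p⁴`). [cite: SilvermanAEC2009, III.1 (b₂, b₄, b₆, b₈, Δ)] -/
theorem WInt_Δ (p : ℕ) (hp4 : p % 4 = 3) :
    (⟨1, -(((21 * p + 1) / 4 : ℕ) : ℤ), 0, 7 * (p : ℤ) ^ 2, 0⟩ : WeierstrassCurve ℤ).Δ = -343 * (p : ℤ) ^ 6 := by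
  have hK : (4 : ℤ) * (((21 * p + 1) / 4 : ℕ) : ℤ) = 21 * p + 1 := by exact_mod_cast four_mul_div p hp4
  simp only [WeierstrassCurve.Δ, WeierstrassCurve.b₂, WeierstrassCurve.b₄, WeierstrassCurve.b₆, WeierstrassCurve.b₈]
  linear_combination (-(49 * (p : ℤ) ^ 4 * (1 - 4 * (((21 * p + 1) / 4 : ℕ) : ℤ) - 21 * p))) * hK

/-- `Δ(W_p) = −7³ p⁶` over `ℚ`. [cite: SilvermanAEC2009, III.1] -/
theorem W_Δ (p : ℕ) (hp4 : p % 4 = 3) :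
    (⟨1, -(((21 * p + 1) / 4 : ℕ) : ℚ), 0, 7 * (p : ℚ) ^ 2, 0⟩ : WeierstrassCurve ℚ).Δ = -343 * (p : ℚ) ^ 6 := by
  rw [← map_WInt, WeierstrassCurve.map_Δ, WInt_Δ p hp4]
  simp

/-- **`W_p` is an elliptic curve** for a prime `p ≡ 3 (mod 4)` (`Δ = −343p⁶ ≠ 0`). [folklore] -/
theorem isElliptic_W (p : ℕ) (hp : p.Prime) (hp4 : p % 4 = 3) :
    (⟨1, -(((21 * p + 1) / 4 : ℕ) : ℚ), 0, 7 * (p : ℚ) ^ 2, 0⟩ : WeierstrassCurve ℚ).IsElliptic := by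
  rw [WeierstrassCurve.isElliptic_iff, W_Δ p hp4, isUnit_iff_ne_zero]
  have : (p : ℚ) ≠ 0 := by exact_mod_cast hp.ne_zero
  positivity

/-- A prime `r ∉ {7, p}` does not divide `Δ(W_p) = −7³p⁶` — in particular `r = 2` does not. [folklore] -/
theorem not_dvd_WInt_Δ {p r : ℕ} (hp : p.Prime) (hp4 : p % 4 = 3) (hr : r.Prime) (hr7 : r ≠ 7) (hrp : r ≠ p) :
    ¬ (r : ℤ) ∣ (⟨1, -(((21 * p + 1) / 4 : ℕ) : ℤ), 0, 7 * (p : ℤ) ^ 2, 0⟩ : WeierstrassCurve ℤ).Δ := by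
  rw [WInt_Δ p hp4, show (-343 * (p : ℤ) ^ 6) = -((7 ^ 3 * p ^ 6 : ℕ) : ℤ) by push_cast; ring, dvd_neg]
  intro h
  have h' : r ∣ 7 ^ 3 * p ^ 6 := by exact_mod_cast h
  rcases (Nat.Prime.dvd_mul hr).mp h' with h7 | hp6
  · exact hr7 ((Nat.prime_dvd_prime_iff_eq hr (by norm_num)).mp (hr.dvd_of_dvd_pow h7))
  · exact hrp ((Nat.prime_dvd_prime_iff_eq hr hp).mp (hr.dvd_of_dvd_pow hp6))

/-- **`W_p` has good reduction at every prime `r ∉ {7, p}`**, `r = 2` included (the model is `2`-integral with odd discriminant).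
[cite: SilvermanAEC2009, VII.5 Prop. 5.1(a)] -/
theorem hasGoodReductionAtPrime_W {p r : ℕ} [Fact r.Prime] (hp : p.Prime) (hp4 : p % 4 = 3) (hr7 : r ≠ 7) (hrp : r ≠ p) :
    (⟨1, -(((21 * p + 1) / 4 : ℕ) : ℚ), 0, 7 * (p : ℚ) ^ 2, 0⟩ : WeierstrassCurve ℚ).HasGoodReductionAtPrime r := by
  obtain ⟨v, rfl⟩ : ∃ v : HeightOneSpectrum (𝓞 ℚ), (primesEquiv v : ℕ) = r :=
    ⟨primesEquiv.symm ⟨r, Fact.out⟩, by rw [Equiv.apply_symm_apply]⟩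
  rw [← map_WInt]
  exact (hasGoodReductionAtPrime_iff_hasGoodReductionAt_ringOfIntegers v _).2
    (hasGoodReductionAt_map_of_not_dvd _ v (not_dvd_WInt_Δ hp hp4 Fact.out hr7 hrp))

/-- **Every prime divisor of `N(W_p)` is `7` or `p`** (no modularity: a prime of good reduction does not divide the conductor).
[cite: SilvermanATAEC1994, Thm. IV.10.2(a)] -/
theorem eq_seven_or_eq_of_prime_dvd_conductorNorm_W {p r : ℕ} (hp : p.Prime) (hp4 : p % 4 = 3)
    [(⟨1, -(((21 * p + 1) / 4 : ℕ) : ℚ), 0, 7 * (p : ℚ) ^ 2, 0⟩ : WeierstrassCurve ℚ).IsElliptic] (hr : r.Prime)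
    (h : r ∣ (⟨1, -(((21 * p + 1) / 4 : ℕ) : ℚ), 0, 7 * (p : ℚ) ^ 2, 0⟩ : WeierstrassCurve ℚ).conductorNorm ℤ) : r = 7 ∨ r = p := by
  by_contra hne
  push Not at hne
  haveI : Fact r.Prime := ⟨hr⟩
  exact not_dvd_conductorNorm_of_hasGoodReductionAtPrime _ (hasGoodReductionAtPrime_W hp hp4 hne.1 hne.2) h

/-- ★ **The twist identity `W_p^{(−4ℓ)} = A_{pℓ}` on the nose**: `W_p.quadraticTwist (−4ℓ) = ⟨0, 21pℓ, 0, 112(pℓ)², 0⟩`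
(`b₂(W_p) = −21p`, `b₄ = 14p²`, `b₆ = 0`; the even discriminant `−4ℓ` absorbs the `/4` of the twist formula). [cite: SilvermanAEC2009, X.5 Cor. 5.4(iii)] -/
theorem quadraticTwist_W (p ℓ : ℕ) (hp4 : p % 4 = 3) :
    (⟨1, -(((21 * p + 1) / 4 : ℕ) : ℚ), 0, 7 * (p : ℚ) ^ 2, 0⟩ : WeierstrassCurve ℚ).quadraticTwist (((-(4 * (ℓ : ℤ)) : ℤ) : ℚ)) =
      ⟨0, 21 * ((p * ℓ : ℕ) : ℚ), 0, 112 * ((p * ℓ : ℕ) : ℚ) ^ 2, 0⟩ := by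
  have hK : (4 : ℚ) * (((21 * p + 1) / 4 : ℕ) : ℚ) = 21 * p + 1 := by exact_mod_cast four_mul_div p hp4
  ext
  · simp
  · simp only [quadraticTwist_a₂, b₂]; push_cast; linear_combination (ℓ : ℚ) * hK
  · simp
  · simp only [quadraticTwist_a₄, b₄]; push_cast; ring
  · simp only [quadraticTwist_a₆, b₆]; push_cast; ring

end Family

/-! ## §2 `L(A_n, 1) ≠ 0` on CELL-√7, modulo Burungale–Tian + Deuring–Hecke -/

section LValue

/-- **`j(A_n) = −3375`** (`j = 256(a² − 3b)³/(b²(a² − 4b))`, `a² − 3b = 105n²`, `b²(a² − 4b) = −87808n⁶`). [cite: SilvermanATAEC1994, App. A §3 (D = −7)] -/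
theorem j_A {n : ℕ} (hn : n ≠ 0) [hE : (⟨0, 21 * (n : ℚ), 0, 112 * (n : ℚ) ^ 2, 0⟩ : WeierstrassCurve ℚ).IsElliptic] :
    (⟨0, 21 * (n : ℚ), 0, 112 * (n : ℚ) ^ 2, 0⟩ : WeierstrassCurve ℚ).j = -3375 := by
  rw [j_mk_twoTorsion]
  have h6 : (n : ℚ) ^ 6 ≠ 0 := pow_ne_zero 6 (by exact_mod_cast hn)
  have hb : (112 * (n : ℚ) ^ 2) ^ 2 * ((21 * (n : ℚ)) ^ 2 - 4 * (112 * (n : ℚ) ^ 2)) = -87808 * (n : ℚ) ^ 6 := by ring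
  have hb0 : (112 * (n : ℚ) ^ 2) ^ 2 * ((21 * (n : ℚ)) ^ 2 - 4 * (112 * (n : ℚ) ^ 2)) ≠ 0 := by
    rw [hb]; exact mul_ne_zero (by norm_num) h6
  rw [div_eq_iff hb0, hb]
  ring

/-- `j(A_n) ∈ maximalCMJInvariants` and **`A_n` has complex multiplication** (by `ℤ[(1+√−7)/2]`; tree theorem
`hasCM_of_j_mem_maximalCMJInvariants_holds`). [cite: SilvermanATAEC1994, App. A §3] -/
theorem j_A_mem_and_hasCM {n : ℕ} (hn : n ≠ 0) [hE : (⟨0, 21 * (n : ℚ), 0, 112 * (n : ℚ) ^ 2, 0⟩ : WeierstrassCurve ℚ).IsElliptic] :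
    (⟨0, 21 * (n : ℚ), 0, 112 * (n : ℚ) ^ 2, 0⟩ : WeierstrassCurve ℚ).j ∈ maximalCMJInvariants ∧
      (⟨0, 21 * (n : ℚ), 0, 112 * (n : ℚ) ^ 2, 0⟩ : WeierstrassCurve ℚ).HasCM := by
  have hj : (⟨0, 21 * (n : ℚ), 0, 112 * (n : ℚ) ^ 2, 0⟩ : WeierstrassCurve ℚ).j ∈ maximalCMJInvariants := by
    rw [j_A hn]; simp [maximalCMJInvariants]
  exact ⟨hj, hasCM_of_j_mem_maximalCMJInvariants_holds _ hj⟩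

variable {q m : ℕ}

/-- ★ **CELL-√7, `L`-form: `r_an(A_n) = 0` and `L(A_n, 1) ≠ 0`** for `n = q m` in the cell, modulo Burungale–Tian (`corank_{ℤ₂} Sel_{2^∞} = 0`
from `…SqrtSevenCell.selmerCorank_two_eq_zero` and CM give `r_an = 0`; the fact allows the prime `2`) and Deuring–Hecke (`L(A_n, s)` entire as
`j = −3375 ∈ maximalCMJInvariants`, to read `r_an = 0` as `L(1) ≠ 0` via `analyticRank_eq_zero_iff_holds`).
[cite: BurungaleTian2026, Thm. 1.1] [cite: SilvermanATAEC1994, Ch. II Cor. 10.5.1] -/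
theorem L_one_ne_zero_A (hBT : burungaleTian_analyticRank_eq_zero_of_selmerCorank_eq_zero_of_hasCM)
    (hH : hasEntireLFunction_of_j_mem_maximalCMJInvariants) (hq : q.Prime) (hq8 : q % 8 = 3)
    (hq7 : q % 7 = 3 ∨ q % 7 = 5 ∨ q % 7 = 6) (hm0 : 0 < m) (hmsq : Squarefree m) (hqm : ¬ q ∣ m)
    (hm : ∀ r : ℕ, r.Prime → r ∣ m → r % 4 = 1 ∧ (r % 7 = 3 ∨ r % 7 = 5 ∨ r % 7 = 6))
    [hE : (⟨0, 21 * ((q * m : ℕ) : ℚ), 0, 112 * ((q * m : ℕ) : ℚ) ^ 2, 0⟩ : WeierstrassCurve ℚ).IsElliptic] :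
    (⟨0, 21 * ((q * m : ℕ) : ℚ), 0, 112 * ((q * m : ℕ) : ℚ) ^ 2, 0⟩ : WeierstrassCurve ℚ).analyticRank = 0 ∧
      (⟨0, 21 * ((q * m : ℕ) : ℚ), 0, 112 * ((q * m : ℕ) : ℚ) ^ 2, 0⟩ : WeierstrassCurve ℚ).entireLFunction 1 ≠ 0 := by
  haveI : Fact (Nat.Prime 2) := ⟨Nat.prime_two⟩
  have hn0 : (q * m : ℕ) ≠ 0 := Nat.mul_ne_zero hq.ne_zero hm0.ne'
  obtain ⟨hj, hCM⟩ := j_A_mem_and_hasCM hn0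
  have h0 := hBT _ hCM 2 (selmerCorank_two_eq_zero hq hq8 hq7 hm0 hmsq hqm hm)
  exact ⟨h0, (analyticRank_eq_zero_iff_holds (W := (⟨0, 21 * ((q * m : ℕ) : ℚ), 0, 112 * ((q * m : ℕ) : ℚ) ^ 2, 0⟩ :
    WeierstrassCurve ℚ)) (hH _ hj)).1 h0⟩

end LValue

/-! ## §3 ★★★ The corner: every prime `p ≡ 3, 19, 27 (mod 56)` -/

section Corner

/-- The data of a corner witness, assembled from a pinned prime `ℓ` and its field (both `p ≥ 23` and `p = 19` feed this). [folklore] -/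
theorem corner_of_witness (hBT : burungaleTian_analyticRank_eq_zero_of_selmerCorank_eq_zero_of_hasCM)
    (hH : hasEntireLFunction_of_j_mem_maximalCMJInvariants) {p : ℕ} (hp : p.Prime) (hp8 : p % 8 = 3)
    (hp7 : p % 7 = 3 ∨ p % 7 = 5 ∨ p % 7 = 6) {ℓ : ℕ} {K : Type} [Field K] [NumberField K] (hℓ : ℓ.Prime) (hℓ4 : ℓ % 4 = 1)
    (hℓ7 : ℓ % 7 = 3 ∨ ℓ % 7 = 5 ∨ ℓ % 7 = 6) (hℓp : ℓ ≠ p) (hK : IsImaginaryQuadratic K) (hdK : NumberField.discr K = -(4 * (ℓ : ℤ)))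
    (hHg : SatisfiesHeegnerHypothesis ((⟨1, -(((21 * p + 1) / 4 : ℕ) : ℚ), 0, 7 * (p : ℚ) ^ 2, 0⟩ : WeierstrassCurve ℚ).conductorNorm ℤ) K)
    (hcl : NumberField.classNumber K < p) :
    ∃ (K : Type) (_ : Field K) (_ : NumberField K),
      IsImaginaryQuadratic K ∧ 4 < (NumberField.discr K).natAbs ∧
      SatisfiesHeegnerHypothesis ((⟨1, -(((21 * p + 1) / 4 : ℕ) : ℚ), 0, 7 * (p : ℚ) ^ 2, 0⟩ : WeierstrassCurve ℚ).conductorNorm ℤ) K ∧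
      ((⟨1, -(((21 * p + 1) / 4 : ℕ) : ℚ), 0, 7 * (p : ℚ) ^ 2, 0⟩ : WeierstrassCurve ℚ).quadraticTwist
        (NumberField.discr K : ℚ)).entireLFunction 1 ≠ 0 ∧
      NumberField.classNumber K < p ∧ ¬ p ∣ NumberField.classNumber K := by
  refine ⟨K, inferInstance, inferInstance, hK, ?_, hHg, ?_, hcl, fun hdvd =>
    absurd (Nat.le_of_dvd (NumberField.classNumber_pos K) hdvd) (not_le.mpr hcl)⟩
  · rw [hdK, Int.natAbs_neg, show (4 * (ℓ : ℤ)) = ((4 * ℓ : ℕ) : ℤ) by push_cast; ring, Int.natAbs_natCast]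
    have := hℓ.two_le
    omega
  · -- `W_p^{(−4ℓ)} = A_{pℓ}` is in CELL-√7 with `q = p`, `m = ℓ`
    rw [hdK, quadraticTwist_W p ℓ (by omega)]
    have hpℓ : ¬ p ∣ ℓ := fun h => hℓp ((Nat.prime_dvd_prime_iff_eq hp hℓ).mp h).symm
    haveI := isElliptic_A (Nat.mul_ne_zero hp.ne_zero hℓ.ne_zero)
    exact (L_one_ne_zero_A hBT hH hp hp8 hp7 hℓ.pos hℓ.squarefree hpℓ (fun r hr hrℓ => by
      rw [(Nat.prime_dvd_prime_iff_eq hr hℓ).mp hrℓ]; exact ⟨hℓ4, hℓ7⟩)).2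

/-- ★★★ **THE `j = −3375` CORNER, TWO NAMED FACTS.** For EVERY prime `p ≥ 5`, `p ≡ 3 (mod 8)`, `p ≡ 3, 5, 6 (mod 7)` (i.e. `p ≡ 3, 19, 27 (mod 56)`:
`p` inert in `ℚ(√−7)`, the CM-inert half of type `(3 mod 8)`) and `W = W_p : y² + xy = x³ − ((21p+1)/4) x² + 7p² x` (`= X₀(49)^{(−p)}`, `j = −3375`,
CM by `ℤ[(1+√−7)/2]`, additive at `p`, root number `−1`): there is an imaginary quadratic field `K′` (`= ℚ(√−ℓ)`, `ℓ ≡ 1 (mod 4)` the prime of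
`sqrtSevenPin`, `(ℓ/7) = (ℓ/p) = −1`, `4ℓ < 7p`) with `4 < |d_{K′}| = 4ℓ`, Heegner for `N(W_p)` (every prime divisor of `N(W_p)` is `7` or `p`,
both split in `K′`), `L(W_p^{(d_{K′})}, 1) ≠ 0` (`W_p^{(−4ℓ)} = A_{pℓ}` lies in CELL-√7: complete `2`-isogeny descent, UNCONDITIONAL, then
Burungale–Tian at `2`), `h(K′) < p` and hence `p ∤ h(K′)` — the CONCLUSION of crux 21381 for `W = W_p`, modulo `hBT` (Burungale–Tian) and `hH`
(Deuring–Hecke) only; pin-based, so no ladder and no residual density. The only instance argument is `[Fact p.Prime]`; `W_p` is an elliptic curve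
by `isElliptic_W`. [cite: BurungaleTian2026, Thm. 1.1] [cite: SilvermanATAEC1994, Ch. II Cor. 10.5.1] [cite: SilvermanAEC2009, Prop. X.4.9 and Thm. X.4.2(a)]
[cite: Oesterle1988Gauss, II §3 Proposition p. 57 (27)] -/
theorem cruxOnSqrtSevenCorner_of_two_facts (hBT : burungaleTian_analyticRank_eq_zero_of_selmerCorank_eq_zero_of_hasCM)
    (hH : hasEntireLFunction_of_j_mem_maximalCMJInvariants) :
    ∀ (p : ℕ) [Fact p.Prime], 5 ≤ p → p % 8 = 3 → (p % 7 = 3 ∨ p % 7 = 5 ∨ p % 7 = 6) →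
      ∃ (K : Type) (_ : Field K) (_ : NumberField K),
        IsImaginaryQuadratic K ∧ 4 < (NumberField.discr K).natAbs ∧
        SatisfiesHeegnerHypothesis ((⟨1, -(((21 * p + 1) / 4 : ℕ) : ℚ), 0, 7 * (p : ℚ) ^ 2, 0⟩ : WeierstrassCurve ℚ).conductorNorm ℤ) K ∧
        ((⟨1, -(((21 * p + 1) / 4 : ℕ) : ℚ), 0, 7 * (p : ℚ) ^ 2, 0⟩ : WeierstrassCurve ℚ).quadraticTwist
          (NumberField.discr K : ℚ)).entireLFunction 1 ≠ 0 ∧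
        NumberField.classNumber K < p ∧ ¬ p ∣ NumberField.classNumber K := by
  intro p hpF hp5 hp8 hp7
  have hp : p.Prime := hpF.out
  haveI := isElliptic_W p hp (by omega)
  have hN : ∀ r : ℕ, r.Prime → r ∣ (⟨1, -(((21 * p + 1) / 4 : ℕ) : ℚ), 0, 7 * (p : ℚ) ^ 2, 0⟩ : WeierstrassCurve ℚ).conductorNorm ℤ →
      r = 7 ∨ r = p := fun r hr h => eq_seven_or_eq_of_prime_dvd_conductorNorm_W hp (by omega) hr h
  by_cases h23 : 23 ≤ p
  · obtain ⟨ℓ, K, iF, iN, hℓ, hℓ4, hℓ7, -, hℓp, -, hK, hdK, hHg, hcl⟩ := exists_sqrtSevenPin_witnessField hp hp8 h23 hN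
    exact corner_of_witness hBT hH hp hp8 hp7 hℓ hℓ4 hℓ7 hℓp hK hdK hHg hcl
  · -- below `23`, the only prime `5 ≤ p ≡ 3, 19, 27 (mod 56)` is `19` (`11 % 7 = 4`); its witness is `ℓ = 13`, `K′ = ℚ(√−13)`, `h = 2`
    obtain rfl : p = 19 := by omega
    obtain ⟨ℓ, K, iF, iN, hℓ, hℓ4, hℓ7, -, hℓp, -, hK, hdK, hHg, hcl⟩ := exists_sqrtSevenPin_witnessField_nineteen hN
    exact corner_of_witness hBT hH hp hp8 hp7 hℓ hℓ4 hℓ7 hℓp hK hdK hHg hcl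

end Corner

/-! ## §4 The crux binders are inhabited by `W_p`: global minimality, `N ≠ 0`, `j = −3375`, CM -/

section Binders

variable (v : HeightOneSpectrum (𝓞 ℚ))

/-- The coefficients of `W_p` are `v`-integral at every finite place. [folklore] -/
theorem valuation_W_a_le_one (p : ℕ) :
    v.valuation ℚ (⟨1, -(((21 * p + 1) / 4 : ℕ) : ℚ), 0, 7 * (p : ℚ) ^ 2, 0⟩ : WeierstrassCurve ℚ).a₁ ≤ 1 ∧
      v.valuation ℚ (⟨1, -(((21 * p + 1) / 4 : ℕ) : ℚ), 0, 7 * (p : ℚ) ^ 2, 0⟩ : WeierstrassCurve ℚ).a₂ ≤ 1 ∧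
      v.valuation ℚ (⟨1, -(((21 * p + 1) / 4 : ℕ) : ℚ), 0, 7 * (p : ℚ) ^ 2, 0⟩ : WeierstrassCurve ℚ).a₃ ≤ 1 ∧
      v.valuation ℚ (⟨1, -(((21 * p + 1) / 4 : ℕ) : ℚ), 0, 7 * (p : ℚ) ^ 2, 0⟩ : WeierstrassCurve ℚ).a₄ ≤ 1 ∧
      v.valuation ℚ (⟨1, -(((21 * p + 1) / 4 : ℕ) : ℚ), 0, 7 * (p : ℚ) ^ 2, 0⟩ : WeierstrassCurve ℚ).a₆ ≤ 1 := by
  refine ⟨by simp, ?_, by simp, ?_, by simp⟩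
  · change v.valuation ℚ (-(((21 * p + 1) / 4 : ℕ) : ℚ)) ≤ 1
    rw [Valuation.map_neg, GaloisRepresentations.Rat.valuation_natCast]
    exact HeightOneSpectrum.intValuation_le_one _ _
  · change v.valuation ℚ (7 * (p : ℚ) ^ 2) ≤ 1
    rw [show (7 * (p : ℚ) ^ 2) = ((7 * p ^ 2 : ℕ) : ℚ) by push_cast; ring, GaloisRepresentations.Rat.valuation_natCast]
    exact HeightOneSpectrum.intValuation_le_one _ _

/-- **`ord_v Δ(W_p) < 12` at every finite place** for a prime `p ≡ 3 (mod 4)`, `p ≠ 7`: `Δ = −7³ p⁶`, so `ord₇ Δ = 3`, `ord_p Δ = 6`, `ord_v Δ = 0`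
elsewhere (in particular at `2`). [cite: SilvermanAEC2009, VII.1 Remark 1.1] -/
theorem exp_neg_twelve_lt_valuation_W_Δ {p : ℕ} (hp : p.Prime) (hp4 : p % 4 = 3) (hp7 : p ≠ 7) :
    WithZero.exp (-12 : ℤ) < v.valuation ℚ (⟨1, -(((21 * p + 1) / 4 : ℕ) : ℚ), 0, 7 * (p : ℚ) ^ 2, 0⟩ : WeierstrassCurve ℚ).Δ := by
  rw [W_Δ p hp4, show (-343 * (p : ℚ) ^ 6) = -(((7 : ℕ) : ℚ) ^ 3 * ((p : ℕ) : ℚ) ^ 6) by push_cast; ring, Valuation.map_neg, map_mul,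
    map_pow, map_pow]
  by_cases hv : natGenerator v = 7
  · have h7 : v.valuation ℚ ((7 : ℕ) : ℚ) = WithZero.exp (-1 : ℤ) := by
      rw [← hv]; exact GaloisRepresentations.Rat.valuation_natGenerator v
    have hpv : v.valuation ℚ ((p : ℕ) : ℚ) = 1 := by
      rw [show ((p : ℕ) : ℚ) = ((p : ℤ) : ℚ) by norm_num]
      refine GaloisRepresentations.Rat.valuation_intCast_eq_one v fun h => hp7 ?_
      rw [hv] at h
      exact ((Nat.prime_dvd_prime_iff_eq (by norm_num) hp).mp (by exact_mod_cast h)).symm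
    rw [h7, hpv, one_pow, mul_one, ← WithZero.exp_nsmul, WithZero.exp_lt_exp]
    norm_num
  · have h7 : v.valuation ℚ ((7 : ℕ) : ℚ) = 1 := by
      rw [show ((7 : ℕ) : ℚ) = ((7 : ℤ) : ℚ) by norm_num]
      refine GaloisRepresentations.Rat.valuation_intCast_eq_one v fun h => hv ?_
      exact (Nat.prime_dvd_prime_iff_eq (prime_natGenerator v) (by norm_num)).mp (by exact_mod_cast h)
    rw [h7, one_pow, one_mul]
    by_cases hvp : natGenerator v = p
    · have hpv : v.valuation ℚ ((p : ℕ) : ℚ) = WithZero.exp (-1 : ℤ) := by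
        rw [← hvp]; exact GaloisRepresentations.Rat.valuation_natGenerator v
      rw [hpv, ← WithZero.exp_nsmul, WithZero.exp_lt_exp]
      norm_num
    · have hpv : v.valuation ℚ ((p : ℕ) : ℚ) = 1 := by
        rw [show ((p : ℕ) : ℚ) = ((p : ℤ) : ℚ) by norm_num]
        refine GaloisRepresentations.Rat.valuation_intCast_eq_one v fun h => hvp ?_
        exact (Nat.prime_dvd_prime_iff_eq (prime_natGenerator v) hp).mp (by exact_mod_cast h)
      rw [hpv, one_pow, ← WithZero.exp_zero, WithZero.exp_lt_exp]
      norm_num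

/-- ★ **`W_p : y² + xy = x³ − ((21p+1)/4) x² + 7p² x` is a global minimal Weierstrass equation** for every prime `p ≡ 3 (mod 4)`, `p ≠ 7` (integral, and
`ord_v Δ < 12` everywhere — Silverman VII.1 Remark 1.1 via the tree's `isMinimalAt_of_lt_valuation_Δ_holds`): the crux binder `[W.IsGloballyMinimal]` is
satisfied by `W = W_p`. [cite: SilvermanAEC2009, VII.1 Remark 1.1 and VIII.8] -/
theorem isGloballyMinimal_W {p : ℕ} (hp : p.Prime) (hp4 : p % 4 = 3) (hp7 : p ≠ 7) :
    (⟨1, -(((21 * p + 1) / 4 : ℕ) : ℚ), 0, 7 * (p : ℚ) ^ 2, 0⟩ : WeierstrassCurve ℚ).IsGloballyMinimal where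
  isIntegral := isIntegral_of_exists_lift _ ⟨1, by simp⟩ ⟨-(((21 * p + 1) / 4 : ℕ) : 𝓞 ℚ), by rw [map_neg, map_natCast]⟩
    ⟨0, by simp⟩ ⟨((7 * p ^ 2 : ℕ) : 𝓞 ℚ), by rw [map_natCast]; push_cast; ring⟩ ⟨0, by simp⟩
  isMinimal v := by
    obtain ⟨h₁, h₂, h₃, h₄, h₆⟩ := valuation_W_a_le_one v p
    exact isMinimalAt_of_lt_valuation_Δ_holds
      ((⟨1, -(((21 * p + 1) / 4 : ℕ) : ℚ), 0, 7 * (p : ℚ) ^ 2, 0⟩ : WeierstrassCurve ℚ).isIntegralAt_of_valuation_le_one v h₁ h₂ h₃ h₄ h₆)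
      (exp_neg_twelve_lt_valuation_W_Δ v hp hp4 hp7)

/-- `N(W_p) ≠ 0` (the crux binder `[NeZero (W.conductorNorm ℤ)]`; tree theorem `conductorNorm_pos_holds`). [folklore] -/
theorem neZero_conductorNorm_W (p : ℕ) [(⟨1, -(((21 * p + 1) / 4 : ℕ) : ℚ), 0, 7 * (p : ℚ) ^ 2, 0⟩ : WeierstrassCurve ℚ).IsElliptic] :
    NeZero ((⟨1, -(((21 * p + 1) / 4 : ℕ) : ℚ), 0, 7 * (p : ℚ) ^ 2, 0⟩ : WeierstrassCurve ℚ).conductorNorm ℤ) :=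
  ⟨((⟨1, -(((21 * p + 1) / 4 : ℕ) : ℚ), 0, 7 * (p : ℚ) ^ 2, 0⟩ : WeierstrassCurve ℚ).conductorNorm_pos_holds).ne'⟩

/-- `c₄(W_p) = 105 p²` (`b₂² − 24 b₄ = 441p² − 336p²`). [cite: SilvermanAEC2009, III.1] -/
theorem W_c₄ (p : ℕ) (hp4 : p % 4 = 3) :
    (⟨1, -(((21 * p + 1) / 4 : ℕ) : ℚ), 0, 7 * (p : ℚ) ^ 2, 0⟩ : WeierstrassCurve ℚ).c₄ = 105 * (p : ℚ) ^ 2 := by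
  have hK : (4 : ℚ) * (((21 * p + 1) / 4 : ℕ) : ℚ) = 21 * p + 1 := by exact_mod_cast four_mul_div p hp4
  simp only [WeierstrassCurve.c₄, WeierstrassCurve.b₂, WeierstrassCurve.b₄]
  linear_combination (4 * (((21 * p + 1) / 4 : ℕ) : ℚ) + 21 * p - 1) * hK

/-- **`j(W_p) = −3375 = −15³`** (`j = c₄³/Δ = (105p²)³/(−343p⁶)`), one of the nine maximal-order CM `j`-invariants, and **`W_p` has complex multiplication**
(by `ℤ[(1+√−7)/2]`; the crux hypothesis `HasCM`, for the record). [cite: SilvermanATAEC1994, App. A §3 (D = −7)] -/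
theorem j_W_and_hasCM {p : ℕ} (hp : p.Prime) (hp4 : p % 4 = 3)
    [hE : (⟨1, -(((21 * p + 1) / 4 : ℕ) : ℚ), 0, 7 * (p : ℚ) ^ 2, 0⟩ : WeierstrassCurve ℚ).IsElliptic] :
    (⟨1, -(((21 * p + 1) / 4 : ℕ) : ℚ), 0, 7 * (p : ℚ) ^ 2, 0⟩ : WeierstrassCurve ℚ).j = -3375 ∧
      (⟨1, -(((21 * p + 1) / 4 : ℕ) : ℚ), 0, 7 * (p : ℚ) ^ 2, 0⟩ : WeierstrassCurve ℚ).HasCM := by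
  have hp0 : (p : ℚ) ≠ 0 := by exact_mod_cast hp.ne_zero
  have hj : (⟨1, -(((21 * p + 1) / 4 : ℕ) : ℚ), 0, 7 * (p : ℚ) ^ 2, 0⟩ : WeierstrassCurve ℚ).j = -3375 := by
    rw [WeierstrassCurve.j, Units.val_inv_eq_inv_val, WeierstrassCurve.coe_Δ', W_Δ p hp4, W_c₄ p hp4]
    have h6 : (p : ℚ) ^ 6 ≠ 0 := pow_ne_zero 6 hp0
    field_simp
    ring
  refine ⟨hj, hasCM_of_j_mem_maximalCMJInvariants_holds _ ?_⟩
  rw [hj]; simp [maximalCMJInvariants]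

/-- ★★★ **The `j = −3375` corner WITH THE CRUX BINDERS** (`IsElliptic`, `IsGloballyMinimal`, `NeZero N` — all inhabited by `W_p`: `isElliptic_W`,
`isGloballyMinimal_W`, `neZero_conductorNorm_W`) and the crux hypothesis `HasCM` (inhabited: `j_W_and_hasCM`): same conclusion as
`cruxOnSqrtSevenCorner_of_two_facts`, stated in the crux's own shape for `W = W_p`, every prime `p ≥ 5` with `p ≡ 3, 19, 27 (mod 56)`, modulo
Burungale–Tian + Deuring–Hecke only. BSD is not proved by this; crux 21381 is not closed by corner theorems. [cite: BurungaleTian2026, Thm. 1.1]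
[cite: SilvermanATAEC1994, Ch. II Cor. 10.5.1] [cite: SilvermanAEC2009, VII.1 Remark 1.1] -/
theorem cruxOnSqrtSevenCorner (hBT : burungaleTian_analyticRank_eq_zero_of_selmerCorank_eq_zero_of_hasCM)
    (hH : hasEntireLFunction_of_j_mem_maximalCMJInvariants) :
    ∀ (p : ℕ) [Fact p.Prime] [(⟨1, -(((21 * p + 1) / 4 : ℕ) : ℚ), 0, 7 * (p : ℚ) ^ 2, 0⟩ : WeierstrassCurve ℚ).IsElliptic]
      [(⟨1, -(((21 * p + 1) / 4 : ℕ) : ℚ), 0, 7 * (p : ℚ) ^ 2, 0⟩ : WeierstrassCurve ℚ).IsGloballyMinimal]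
      [NeZero ((⟨1, -(((21 * p + 1) / 4 : ℕ) : ℚ), 0, 7 * (p : ℚ) ^ 2, 0⟩ : WeierstrassCurve ℚ).conductorNorm ℤ)],
      (⟨1, -(((21 * p + 1) / 4 : ℕ) : ℚ), 0, 7 * (p : ℚ) ^ 2, 0⟩ : WeierstrassCurve ℚ).HasCM → 5 ≤ p → p % 8 = 3 →
      (p % 7 = 3 ∨ p % 7 = 5 ∨ p % 7 = 6) →
      ∃ (K : Type) (_ : Field K) (_ : NumberField K),
        IsImaginaryQuadratic K ∧ 4 < (NumberField.discr K).natAbs ∧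
        SatisfiesHeegnerHypothesis ((⟨1, -(((21 * p + 1) / 4 : ℕ) : ℚ), 0, 7 * (p : ℚ) ^ 2, 0⟩ : WeierstrassCurve ℚ).conductorNorm ℤ) K ∧
        ((⟨1, -(((21 * p + 1) / 4 : ℕ) : ℚ), 0, 7 * (p : ℚ) ^ 2, 0⟩ : WeierstrassCurve ℚ).quadraticTwist
          (NumberField.discr K : ℚ)).entireLFunction 1 ≠ 0 ∧
        ¬ p ∣ NumberField.classNumber K :=
  fun p _ _ _ _ _ hp5 hp8 hp7 => by
    obtain ⟨K, iF, iN, hK, h4, hHg, hL, -, hndvd⟩ := cruxOnSqrtSevenCorner_of_two_facts hBT hH p hp5 hp8 hp7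
    exact ⟨K, iF, iN, hK, h4, hHg, hL, hndvd⟩

/-- All four binders/hypotheses of `cruxOnSqrtSevenCorner` are inhabited by `W_p` for every prime `p ≥ 5`, `p ≡ 3 (mod 8)`, `p ≡ 3, 5, 6 (mod 7)`
(so the corner is not vacuous). [cite: SilvermanAEC2009, VII.1 Remark 1.1] -/
theorem binders_W {p : ℕ} (hp : p.Prime) (hp8 : p % 8 = 3) (hp7 : p % 7 = 3 ∨ p % 7 = 5 ∨ p % 7 = 6) :
    ∃ (_ : (⟨1, -(((21 * p + 1) / 4 : ℕ) : ℚ), 0, 7 * (p : ℚ) ^ 2, 0⟩ : WeierstrassCurve ℚ).IsElliptic)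
      (_ : (⟨1, -(((21 * p + 1) / 4 : ℕ) : ℚ), 0, 7 * (p : ℚ) ^ 2, 0⟩ : WeierstrassCurve ℚ).IsGloballyMinimal)
      (_ : NeZero ((⟨1, -(((21 * p + 1) / 4 : ℕ) : ℚ), 0, 7 * (p : ℚ) ^ 2, 0⟩ : WeierstrassCurve ℚ).conductorNorm ℤ)),
      (⟨1, -(((21 * p + 1) / 4 : ℕ) : ℚ), 0, 7 * (p : ℚ) ^ 2, 0⟩ : WeierstrassCurve ℚ).HasCM := by
  haveI := isElliptic_W p hp (by omega)
  exact ⟨inferInstance, isGloballyMinimal_W hp (by omega) (by rintro rfl; omega), neZero_conductorNorm_W p,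
    (j_W_and_hasCM hp (by omega)).2⟩

end Binders

end Summit.BirchSwinnertonDyer.BirchSwinnertonDyer.Theorems.BiquadraticEisensteinDescentHeegnerTwistCouplingInSupplySqrtSevenCorner

end
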